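import Summits.QuantumFields.YangMills.Theorems.LuscherReductionTwistedTraceScalingBOCentralEventually
import Summits.QuantumFields.YangMills.Theorems.LuscherReductionTwistedTraceScalingBOCentralModelBounds
import Summits.QuantumFields.YangMills.Theorems.LuscherReductionTwistedTraceScalingBTHaarFloor
import HarnessLib

/-!
# (B-O) central tube — the gauge-far term of the upper bound of record is negligible (schedule B)

Companion of `…BOCentralRecord` / `…BOCentralRates{,Two,Three}`.  The gauge-far contribution of the upper bound,
`e^{2β|E|}e^{-βρ²/4}·e^{49βR_in²}/stiffGaussTop`, divided by the normaliser of the main term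
`e^{2β|E|}(2π²)^{-|E|}·fpZ(β^{-1})·N̄(β^{-1})`, tends to `0`: `e^{-βρ²/4} ≤ e^{-ℓ⁴}` is super-polynomially small while every other
factor is polynomial in `β = e^{ℓ}` (`fpZ(ε) ≥ ε³/80` from the Haar floor, `N̄(ε) ≥ (2π²)^{-n}ε^{d}/√G₀`,
`1/stiffGaussTop ≤ (98β)^{3|E|}`).
-/

open MeasureTheory Filter Topology Real
open scoped BigOperators
open Literature.MathematicalPhysics.QuantumFieldTheory
open Literature.MathematicalPhysics.QuantumLattice

namespace Summit.QuantumFields.YangMills.Theorems.FemtoTransferGap.TwoLattice.ConstTube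

open Summit.QuantumFields.YangMills.Theorems.FemtoTransferGap
open Summit.QuantumFields.YangMills.Theorems.FemtoTransferGap.TwoLattice
open Summit.QuantumFields.YangMills.Theorems.FemtoTransferGap.TwoLattice.Stiff

variable {L : ℕ} [NeZero L]

omit [NeZero L] in
/-- **Haar floor of the colour ball**: `fpZ(ε) ≥ ε³/80` for `0 < ε ≤ 1`. [folklore] -/
theorem fpZ_ge {ε : ℝ} (hε : 0 < ε) (hε1 : ε ≤ 1) : ε ^ 3 / 80 ≤ fpZ ε := by
  have hsub : quatBall (ε / 2) ⊆ fpBall ε := by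
    intro c hc
    simp only [quatBall, Set.mem_setOf_eq] at hc
    simp only [fpBall, Set.mem_setOf_eq]
    linarith
  have h1 := haarReal_quatBall_ge (ρ := ε / 2) (by positivity) (by linarith)
  have h2 : (haarProbability SU2).real (quatBall (ε / 2)) ≤ (haarProbability SU2).real (fpBall ε) :=
    measureReal_mono hsub
  unfold fpZ
  have e : ε ^ 3 / 80 = (ε / 2) ^ 3 / 10 := by ring
  rw [e]; exact h1.trans h2

/-- **Floor of the flat Laplace normaliser**: `N̄(ε) ≥ (2π²)^{-n}·ε^{d}/√G₀` for `0 < ε`. [folklore] -/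
theorem fpWeightBar_ge {ε : ℝ} (hε : 0 < ε) :
    ((2 * π ^ 2)⁻¹) ^ Fintype.card (NzSite L) * ε ^ flatDim L / Real.sqrt (gramDet L 0) ≤ fpWeightBar L ε := by
  unfold fpWeightBar
  have hG : 0 < Real.sqrt (gramDet L 0) := Real.sqrt_pos.mpr (gramDet_zero_pos L)
  have h1 : ε ^ flatDim L ≤ (π * ε ^ 2) ^ (flatDim L / 2 : ℝ) := by
    have e : ε ^ flatDim L = (ε ^ 2) ^ (flatDim L / 2 : ℝ) := by
      rw [← Real.rpow_natCast ε 2, ← Real.rpow_mul hε.le, ← Real.rpow_natCast]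
      congr 1; push_cast; ring
    rw [e]
    apply Real.rpow_le_rpow (by positivity) _ (by positivity)
    have : (1 : ℝ) ≤ π := by linarith [Real.pi_gt_three]
    nlinarith [sq_nonneg ε]
  gcongr

/-- `1/stiffGaussTop ≤ (98β)^{3|E|}` for `β ≥ 1`. [folklore] -/
theorem inv_stiffGaussTop_le {β : ℝ} (hβ : 1 ≤ β) : (stiffGaussTop L (β / 2) β)⁻¹ ≤ (98 * β) ^ Fintype.card (Edge 3 L × Fin 3) := by
  have hβ0 : 0 < β := by linarith
  obtain ⟨hSlo, -⟩ := stiffGaussTop_record_bounds (L := L) hβ0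
  have hq : (98 * β)⁻¹ ≤ Real.sqrt (π / (98 * β)) := by
    have h1 : (98 * β)⁻¹ = Real.sqrt (((98 * β)⁻¹) ^ 2) := (Real.sqrt_sq (by positivity)).symm
    rw [h1]
    apply Real.sqrt_le_sqrt
    rw [div_eq_mul_inv]
    have h98 : 0 < (98 * β)⁻¹ := by positivity
    have h3 : (98 * β)⁻¹ ≤ 1 := inv_le_one_of_one_le₀ (by linarith)
    have hπ : (1 : ℝ) ≤ π := by linarith [Real.pi_gt_three]
    nlinarith
  have hS0 : 0 < ((98 * β)⁻¹) ^ Fintype.card (Edge 3 L × Fin 3) := by positivity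
  have hS : ((98 * β)⁻¹) ^ Fintype.card (Edge 3 L × Fin 3) ≤ stiffGaussTop L (β / 2) β :=
    (pow_le_pow_left₀ (by positivity) hq _).trans hSlo
  calc (stiffGaussTop L (β / 2) β)⁻¹ ≤ (((98 * β)⁻¹) ^ Fintype.card (Edge 3 L × Fin 3))⁻¹ := inv_anti₀ hS0 hS
    _ = (98 * β) ^ Fintype.card (Edge 3 L × Fin 3) := by rw [inv_pow, inv_inv]

/-- ★ **The gauge-far term is negligible**: `e^{-βρ²/4}·e^{49βR_in²}/stiffGaussTop / ((2π²)^{-|E|}·fpZ(β^{-1})·N̄(β^{-1})) → 0`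
along schedule B. [folklore] -/
theorem tendsto_farTail :
    Tendsto (fun β : ℝ => Real.exp (-(β * (8 * (9 * (L : ℝ) * (5 * (powScale (1 / 2) β * btLog β ^ 2)) + powScale 1 β)) ^ 2 / 4)) *
        Real.exp (49 * β * (min (1 / 40) (powScale (1 / 2) β * btLog β) / 12) ^ 2) / stiffGaussTop L (β / 2) β /
      (((2 * π ^ 2)⁻¹) ^ Fintype.card (Edge 3 L) * fpZ (powScale 1 β) * fpWeightBar L (powScale 1 β))) atTop (𝓝 0) := by
  set n := Fintype.card (Edge 3 L × Fin 3) with hndef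
  set d := flatDim L with hddef
  set C : ℝ := (98 : ℝ) ^ n * ((2 * π ^ 2) ^ Fintype.card (Edge 3 L) * 80 * ((2 * π ^ 2) ^ Fintype.card (NzSite L) * Real.sqrt (gramDet L 0))) with hCdef
  have hG : 0 < Real.sqrt (gramDet L 0) := Real.sqrt_pos.mpr (gramDet_zero_pos L)
  have hC : 0 ≤ C := by rw [hCdef]; positivity
  have hup : Tendsto (fun β : ℝ => C * Real.exp (-btLog β)) atTop (𝓝 0) := by
    simpa using (Real.tendsto_exp_atBot.comp (tendsto_neg_atTop_atBot.comp tendsto_btLog_atTop)).const_mul C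
  have hrf : ∀ᶠ β : ℝ in atTop, powScale (1 / 2) β * btLog β < 1 / 40 := tendsto_rf.eventually (Iio_mem_nhds (by norm_num))
  have hℓ2 : ∀ᶠ β : ℝ in atTop, ((n : ℝ) + d + 5) ≤ btLog β ^ 2 :=
    ((tendsto_pow_atTop two_ne_zero).comp tendsto_btLog_atTop).eventually_ge_atTop _
  refine tendsto_of_tendsto_of_tendsto_of_le_of_le' tendsto_const_nhds hup ?_ ?_
  · filter_upwards [eventually_gt_atTop (0 : ℝ)] with β hβ
    obtain ⟨hSlo, -⟩ := stiffGaussTop_record_bounds (L := L) hβ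
    have hS : 0 < stiffGaussTop L (β / 2) β := lt_of_lt_of_le (pow_pos (Real.sqrt_pos.2 (by positivity)) _) hSlo
    have hZ := fpZ_pos (powScale_pos 1 β)
    have hW := fpWeightBar_pos (L := L) (powScale_pos 1 β)
    positivity
  · filter_upwards [eventually_ge_atTop (1 : ℝ), eventually_btLog_eq, hrf, hℓ2] with β hβ hℓeq hrf' hl2
    have hβ0 : 0 < β := by linarith
    have hℓ := one_le_btLog β
    set ℓ := btLog β with hℓdef
    set ε := powScale 1 β with hεdef
    set x := powScale (1 / 2) β with hxdef
    have hε : 0 < ε := powScale_pos 1 β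
    have hε1 : ε ≤ 1 := powScale_le_one (by norm_num) β
    have hx0 : 0 ≤ x := (powScale_pos _ _).le
    have hβε : β * ε = 1 := mul_powScale_one hβ
    have hβx : β * x ^ 2 = 1 := mul_powScale_half_sq hβ
    have hexpℓ : Real.exp ℓ = β := by rw [hℓeq, Real.exp_log hβ0]
    obtain ⟨hSlo, -⟩ := stiffGaussTop_record_bounds (L := L) hβ0
    have hS : 0 < stiffGaussTop L (β / 2) β := lt_of_lt_of_le (pow_pos (Real.sqrt_pos.2 (by positivity)) _) hSlo
    have hZ := fpZ_pos hε
    have hW := fpWeightBar_pos (L := L) hε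
    -- (1) the Gaussian factor `e^{-βρ²/4} ≤ e^{-ℓ⁴}`
    have h1 : Real.exp (-(β * (8 * (9 * (L : ℝ) * (5 * (x * ℓ ^ 2)) + ε)) ^ 2 / 4)) ≤ Real.exp (-ℓ ^ 4) := by
      apply Real.exp_le_exp.2
      have hL1 : (1 : ℝ) ≤ L := by exact_mod_cast NeZero.one_le
      have hρ : 2 * (x * ℓ ^ 2) ≤ 8 * (9 * (L : ℝ) * (5 * (x * ℓ ^ 2)) + ε) := by
        have : 0 ≤ x * ℓ ^ 2 := by positivity
        nlinarith
      have hρ2 : (2 * (x * ℓ ^ 2)) ^ 2 ≤ (8 * (9 * (L : ℝ) * (5 * (x * ℓ ^ 2)) + ε)) ^ 2 := pow_le_pow_left₀ (by positivity) hρ 2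
      have : ℓ ^ 4 ≤ β * (8 * (9 * (L : ℝ) * (5 * (x * ℓ ^ 2)) + ε)) ^ 2 / 4 := by
        calc ℓ ^ 4 = β * (2 * (x * ℓ ^ 2)) ^ 2 / 4 := by
              have : β * (2 * (x * ℓ ^ 2)) ^ 2 / 4 = (β * x ^ 2) * ℓ ^ 4 := by ring
              rw [this, hβx, one_mul]
          _ ≤ β * (8 * (9 * (L : ℝ) * (5 * (x * ℓ ^ 2)) + ε)) ^ 2 / 4 := by gcongr
      linarith
    -- (2) the localisation gain `e^{49βR_in²} ≤ e^{ℓ²}`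
    have h2 : Real.exp (49 * β * (min (1 / 40) (x * ℓ) / 12) ^ 2) ≤ Real.exp (ℓ ^ 2) := by
      apply Real.exp_le_exp.2
      rw [min_eq_right hrf'.le]
      have : 49 * β * (x * ℓ / 12) ^ 2 = 49 / 144 * ((β * x ^ 2) * ℓ ^ 2) := by ring
      rw [this, hβx, one_mul]
      nlinarith [sq_nonneg ℓ]
    -- (3) the three polynomial floors
    have h3 := inv_stiffGaussTop_le (L := L) hβ
    have hεinv : ε⁻¹ = β := (eq_inv_of_mul_eq_one_left hβε).symm
    have h4 : (fpZ ε)⁻¹ ≤ 80 * β ^ 3 := by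
      have := fpZ_ge hε hε1
      calc (fpZ ε)⁻¹ ≤ (ε ^ 3 / 80)⁻¹ := inv_anti₀ (by positivity) this
        _ = 80 * β ^ 3 := by rw [inv_div, div_eq_mul_inv, ← inv_pow, hεinv]
    have h5 : (fpWeightBar L ε)⁻¹ ≤ (2 * π ^ 2) ^ Fintype.card (NzSite L) * Real.sqrt (gramDet L 0) * β ^ d := by
      have hfl := fpWeightBar_ge (L := L) hε
      have hpos : 0 < ((2 * π ^ 2)⁻¹) ^ Fintype.card (NzSite L) * ε ^ flatDim L / Real.sqrt (gramDet L 0) := by positivity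
      calc (fpWeightBar L ε)⁻¹ ≤ (((2 * π ^ 2)⁻¹) ^ Fintype.card (NzSite L) * ε ^ flatDim L / Real.sqrt (gramDet L 0))⁻¹ := inv_anti₀ hpos hfl
        _ = (2 * π ^ 2) ^ Fintype.card (NzSite L) * Real.sqrt (gramDet L 0) * β ^ d := by
            rw [hddef, inv_div, div_eq_mul_inv, mul_inv, ← inv_pow, ← inv_pow, inv_inv, hεinv]; ring
    -- (4) powers of `β` are exponentials of `ℓ`
    have hpow : ∀ k : ℕ, β ^ k = Real.exp (k * ℓ) := fun k => by rw [Real.exp_nat_mul, hexpℓ]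
    -- assemble
    have hnum : Real.exp (-(β * (8 * (9 * (L : ℝ) * (5 * (x * ℓ ^ 2)) + ε)) ^ 2 / 4)) * Real.exp (49 * β * (min (1 / 40) (x * ℓ) / 12) ^ 2) /
        stiffGaussTop L (β / 2) β ≤ Real.exp (-ℓ ^ 4) * Real.exp (ℓ ^ 2) * (98 * β) ^ n := by
      rw [div_eq_mul_inv]
      gcongr
    have hden : (((2 * π ^ 2)⁻¹) ^ Fintype.card (Edge 3 L) * fpZ ε * fpWeightBar L ε)⁻¹ ≤
        (2 * π ^ 2) ^ Fintype.card (Edge 3 L) * (80 * β ^ 3) * ((2 * π ^ 2) ^ Fintype.card (NzSite L) * Real.sqrt (gramDet L 0) * β ^ d) := by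
      rw [mul_inv, mul_inv, inv_pow, inv_inv]
      gcongr
    have hkey : Real.exp (-ℓ ^ 4) * Real.exp (ℓ ^ 2) * (98 * β) ^ n *
        ((2 * π ^ 2) ^ Fintype.card (Edge 3 L) * (80 * β ^ 3) * ((2 * π ^ 2) ^ Fintype.card (NzSite L) * Real.sqrt (gramDet L 0) * β ^ d)) ≤
        C * Real.exp (-ℓ) := by
      have hprod : Real.exp (-ℓ ^ 4) * Real.exp (ℓ ^ 2) * Real.exp (n * ℓ) * Real.exp ((3 : ℕ) * ℓ) * Real.exp (d * ℓ) =
          Real.exp (-ℓ ^ 4 + ℓ ^ 2 + n * ℓ + (3 : ℕ) * ℓ + d * ℓ) := by simp only [← Real.exp_add]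
      have e : Real.exp (-ℓ ^ 4) * Real.exp (ℓ ^ 2) * (98 * β) ^ n *
          ((2 * π ^ 2) ^ Fintype.card (Edge 3 L) * (80 * β ^ 3) * ((2 * π ^ 2) ^ Fintype.card (NzSite L) * Real.sqrt (gramDet L 0) * β ^ d)) =
          C * (Real.exp (-ℓ ^ 4) * Real.exp (ℓ ^ 2) * Real.exp (n * ℓ) * Real.exp ((3 : ℕ) * ℓ) * Real.exp (d * ℓ)) := by
        rw [mul_pow, hpow n, hpow 3, hpow d, hCdef]; ring
      rw [e, hprod]
      refine mul_le_mul_of_nonneg_left (Real.exp_le_exp.2 ?_) hC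
      push_cast
      have hn0 : (0 : ℝ) ≤ n := Nat.cast_nonneg _
      have hd0 : (0 : ℝ) ≤ d := Nat.cast_nonneg _
      have hℓ12 : ℓ ≤ ℓ ^ 2 := by
        calc ℓ = ℓ * 1 := (mul_one ℓ).symm
          _ ≤ ℓ * ℓ := mul_le_mul_of_nonneg_left hℓ (by linarith only [hℓ])
          _ = ℓ ^ 2 := (sq ℓ).symm
      have hA : ((n : ℝ) + d + 5) * ℓ ^ 2 ≤ ℓ ^ 4 := by
        calc ((n : ℝ) + d + 5) * ℓ ^ 2 ≤ ℓ ^ 2 * ℓ ^ 2 := mul_le_mul_of_nonneg_right hl2 (sq_nonneg _)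
          _ = ℓ ^ 4 := by ring
      have hB : ((n : ℝ) + d + 4) * ℓ ≤ ((n : ℝ) + d + 4) * ℓ ^ 2 := mul_le_mul_of_nonneg_left hℓ12 (by positivity)
      linarith only [hA, hB]
    have hB0 : 0 ≤ Real.exp (-ℓ ^ 4) * Real.exp (ℓ ^ 2) * (98 * β) ^ n := by positivity
    have hI0 : 0 ≤ (((2 * π ^ 2)⁻¹) ^ Fintype.card (Edge 3 L) * fpZ ε * fpWeightBar L ε)⁻¹ := inv_nonneg.2 (by positivity)
    rw [div_eq_mul_inv]
    exact (mul_le_mul hnum hden hI0 hB0).trans hkey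

end Summit.QuantumFields.YangMills.Theorems.FemtoTransferGap.TwoLattice.ConstTube
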